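import Summits.QuantumFields.BalabanUV.T4Continuum.Support.NE7DeficitSecondVariationFlat
import Summits.QuantumFields.BalabanUV.T4Continuum.Support.NE7DeficitChartSmoothFlat
import Summits.QuantumFields.BalabanUV.T4Continuum.Support.AveragingDeficitDerivWallPeriodic
import Summits.QuantumFields.BalabanUV.T4Continuum.Support.NE3EnergySmallFieldCurl
import Summits.QuantumFields.BalabanUV.T4Continuum.Support.AveragingDeficitTransport
import Summits.QuantumFields.BalabanUV.T4Continuum.Support.GaugeFieldPerturbation
import Summits.QuantumFields.BalabanUV.T4Continuum.Support.MinimalActionRate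
import HarnessLib

/-!
# NE7CoarseCurlEnergyFlat — THE FIRST ESTIMATE BEHIND THE EFFECTIVE QUADRATIC FORM: THE COARSE MAXWELL ENERGY OF THE LINEARISED BLOCK AVERAGE IS BOUNDED BY THE FINE ONE
# (flat configuration, one averaging step; ROAD-G115 §9 executed)

`d = 4`, `L ≥ 1`, coarse period `N ≥ 1`, fine period `M = L·N`, `Q′ = levelQ′ L N 0 1` the linearised block average at the flat configuration.  For every skew fine field
`X ∈ skewSub M` with `X̃ = chartDir X` and every bound `γ` of the flat dressed curl (`‖curlAt 1 X̃ z μ ν‖ ≤ γ`, `μ ≠ ν`; e.g. `γ = 4‖X‖`):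
  `Σ_{P ∈ perWin N} nhsNormSq(curl_1 (Q′X)̃ P) ≤ Σ_{p ∈ perWin M} nhsNormSq(curl_1 X̃ p) + wallConst·√(M⁴·4·#planes)·4·γ·√(curlSq 1 X̃ (periodBox M))`
(**`coarse_curl_energy_le`**).  In particular, if `curl_1 X̃ ≡ 0` on the period box then `curl_1 (Q′X)̃ ≡ 0`: closed fine fields average to closed coarse fields, and — with
✓ `NE7MinActHessianFlatCurl` ∕ ✓ `NE7MinimiserDerivativeFlat` — **THE NULL SPACE OF THE EFFECTIVE QUADRATIC FORM `⟨v, Δ v⟩ = D²(minAct∘chart_1)(0)[v,v]` AT THE FLAT DATUM CONSISTS OF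
CLOSED COARSE FIELDS** (one RG step; see the corollary file).
MECHANISM (the derivative-wall route, no Stokes bookkeeping).  `g(t) := 𝓓(e^{tX̃})`, `𝓓` Bałaban's averaging deficit on the period window pair: (i) ✓ `NE7DeficitSecondVariationFlat`:
`g″(0) = Σ_P‖curl_1 Q′X‖² − Σ_p‖curl_1 X‖²` (nHS squares); (ii) THE PROVED PERIODIC DERIVATIVE WALL ✓ `AveragingDeficitDerivWallPeriodic.deficitDerivWallPer_holds` at `V_t = e^{tX̃}` (re-based by
`vary_add`): `|g′(t)| ≤ wallConst·[√gradFluxSq(V_t)·√curlSq(V_t, X̃) + a(t)²(‖X̃‖₁ + ‖d_{V_t}X̃‖₁)]` with `V_t ∈ SmallField a(t)`, `a(t) = |t|γ + 24e^{|t|α}t²α²` (✓ `smallField_vary_curl'`);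
(iii) `gradFluxSq(V_t) ≤ M⁴·4·#planes·(4a(t))²` (`gradFluxSq_le_of_sup`, `‖covGrad F‖ ≤ 2‖F‖`, ✓ `norm_flux_le_of_smallField`); (iv) `g′(0) = 0`, `g` is `C²` (✓ `NE7DeficitChartSmoothFlat`),
so `|g″(0)| = lim |g′(t)|∕|t| ≤ wallConst·√(M⁴·4·#planes)·4γ·√curlSq(1, X̃)` (continuity of `t ↦ curlSq(V_t, X̃)`, `curlL1(V_t, X̃)` at `0` from ✓ `hasDerivAt_curl_vary`).
Cell `pub-balaban`, rung (B)+1 sub-cell t4, lineage `b2b-balaban-t4-ne7-p1` (CRUX PROVER NE7 #1 = OWNER of BINDER row NE7), generation 115.  Memo `t4/b2b-balaban-t4-ne7-p1-g115/ROAD-G115.md` §9.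
WHAT ([folklore]; 0 def, 0 sorry).  HONEST FRAMING (page 1): ONE averaging step at the FLAT configuration; the constant is VOLUME-DEPENDENT (`√(M⁴…)`) and multiplies `γ·‖curl X̃‖_{ℓ²}` (not yet
`‖curl X̃‖²_{ℓ²}`: `γ ≤ ‖curl X̃‖_{ℓ²}` by periodicity is left to the successor), so this is a QUALITATIVE-PLUS estimate, not Bałaban's uniform bound; nothing of Bałaban's asserted; NOT NE7 as a
spine node, NOT NE3; spine 0∕9; NOT infinite volume, NOT mass gap, NOT BetaPertH, NOT Clay.
-/

set_option autoImplicit false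

open scoped BigOperators Matrix Matrix.Norms.L2Operator Topology
open NormedSpace Finset Set Filter Metric

namespace Summit.QuantumFields.BalabanUV.T4Continuum.NE7CoarseCurlEnergyFlat

open Literature.MathematicalPhysics.QuantumFieldTheory.Balaban1983to89
open B7Prop1Explicit B7Prop2Explicit
open T4AveragingDeficitWall (IsUnitaryCfg IsSkewDir SmallField fineAction deficit blockWindow blockSites curl curlAt curlSq curlL1 dirL1 gradFluxSq flux covGrad vary vary_zero Ad)
open T4AveragingDeficitWallBoundary (IsPeriodicCfg periodBox blockSites_periodBox)
open AveragingDeficitPeriodicCounting (IsPeriodicDir)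
open AveragingDeficitTorusChart (TDir chart chartDir chart_smul isPeriodicDir_chartDir)
open AveragingDeficitTwoLevelPrep (skewSub)
open AveragingDeficitMultiLevelPrep (tower levelQ')
open AveragingDeficitPlaqDeriv (vary_isUnitaryCfg)
open AveragingDeficitTransport (norm_Ad_of_unitary)
open AveragingDeficitDerivWallPeriodic (deficitDerivWallPer_holds hasDerivAt_deficit_vary_per)
open AveragingDeficitDerivWallProof (wallConst wallConst_nonneg)
open MinimalActionLevels (perWin)
open MinimalActionRate (gradFluxSq_le_of_sup)
open MinimalActionWitness (flatCfg isPeriodicCfg_flatCfg)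
open MatrixNorms (nhsNormSq)
open NE3FlatHessianCurl (isUnitaryCfg_flatCfg smallField_flatCfg_zero)
open NE3HessForm (hasDerivAt_curl_vary vary_add)
open NE3EnergySmallFieldCurl (smallField_vary_curl')
open GaugeFieldPerturbation (norm_flux_le_of_smallField)
open NE7SecondOrderChainRule (fderiv_fderiv_comp_clm)
open NE7MinActHessianFlatCurl (fderiv_fderiv_one_one)
open NE7DeficitSecondVariationFlat (deficit_second_variation_flat)
open NE7DeficitChartSmoothFlat (contDiffAt_deficit_chart_flat)

noncomputable section

variable {n : Type} [Fintype n] [DecidableEq n]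

/-- `V e^{s(−ψ)} = V e^{(−s)ψ}`. [folklore] -/
theorem vary_neg {d : ℕ} (V : Site d → Fin d → (Matrix n n ℂ)ˣ) (ψ : Site d → Fin d → Matrix n n ℂ) (s : ℝ) :
    vary V (fun x κ => -ψ x κ) s = vary V ψ (-s) := by
  funext x κ
  simp only [vary, smul_neg, Complex.ofReal_neg, neg_smul]

/-- The dressed curl is odd in the direction. [folklore] -/
theorem curlAt_neg {d : ℕ} (V : Site d → Fin d → (Matrix n n ℂ)ˣ) (ψ : Site d → Fin d → Matrix n n ℂ) (z : Site d) (μ ν : Fin d) :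
    curlAt V (fun x κ => -ψ x κ) z μ ν = -curlAt V ψ z μ ν := by
  simp only [curlAt, Ad, Matrix.mul_neg, Matrix.neg_mul]
  abel

/-- The covariant forward gradient of a plaquette function at a unitary configuration is bounded by two values. [folklore] -/
theorem norm_covGrad_le {d : ℕ} {V : Site d → Fin d → (Matrix n n ℂ)ˣ} (hV : IsUnitaryCfg V) (G : T4AveragingDeficitWall.Plaq d → Matrix n n ℂ)
    (x : Site d) (κ : Fin d) (π : T4AveragingDeficitWall.Plane d) :
    ‖covGrad V G x κ π‖ ≤ ‖G (x + e κ, π)‖ + ‖G (x, π)‖ := by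
  unfold covGrad
  exact (norm_sub_le _ _).trans (by rw [norm_Ad_of_unitary (hV x κ)])

/-- An absolute-value slope bound transfers to the derivative: if `|h t| ≤ B t` near `0` (`t ≠ 0`), `h` has derivative `h′` at `0` with `h 0 = 0`, and `B t ∕ |t| → A`, then `|h′| ≤ A`.
[folklore] -/
theorem abs_deriv_le_of_slope_bound {h B : ℝ → ℝ} {h' A : ℝ} (hd : HasDerivAt h h' 0) (h0 : h 0 = 0)
    (hB : ∀ᶠ t : ℝ in 𝓝[≠] 0, |h t| ≤ B t) (hA : Tendsto (fun t : ℝ => B t / |t|) (𝓝[≠] 0) (𝓝 A)) : |h'| ≤ A := by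
  have hslope : Tendsto (fun t : ℝ => t⁻¹ • (h (0 + t) - h 0)) (𝓝[≠] 0) (𝓝 h') := hd.tendsto_slope_zero
  have habs : Tendsto (fun t : ℝ => |t⁻¹ • (h (0 + t) - h 0)|) (𝓝[≠] 0) (𝓝 |h'|) := hslope.abs
  refine le_of_tendsto_of_tendsto habs hA ?_
  filter_upwards [hB, self_mem_nhdsWithin] with t ht ht0
  rw [zero_add, h0, sub_zero, smul_eq_mul, abs_mul, abs_inv, div_eq_inv_mul]
  exact mul_le_mul_of_nonneg_left ht (inv_nonneg.mpr (abs_nonneg t))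

set_option maxHeartbeats 3200000 in
/-- **THE COARSE MAXWELL ENERGY OF THE LINEARISED BLOCK AVERAGE IS BOUNDED BY THE FINE ONE** (flat configuration, one step; see the module docstring). [folklore] -/
theorem coarse_curl_energy_le [Nonempty n] {L : ℕ} [NeZero L] (hL : 1 ≤ L) (N : ℕ) [NeZero N] (hN : 1 ≤ N)
    (X : ↥(skewSub 4 n (L * N))) {γ : ℝ} (hγ0 : 0 ≤ γ)
    (hγ : ∀ (z : Site 4) (μ ν : Fin 4), μ ≠ ν →
      ‖curlAt (flatCfg : Site 4 → Fin 4 → (Matrix n n ℂ)ˣ) (chartDir (ContinuousLinearMap.id ℝ (Matrix n n ℂ)) (L * N) (X : TDir 4 n (L * N))) z μ ν‖ ≤ γ) :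
    haveI : NeZero (L * N) := ⟨Nat.mul_ne_zero (NeZero.ne L) (NeZero.ne N)⟩
    ∑ P ∈ perWin 4 N, nhsNormSq (curl (flatCfg : Site 4 → Fin 4 → (Matrix n n ℂ)ˣ)
        (chartDir (ContinuousLinearMap.id ℝ (Matrix n n ℂ)) N
          ((levelQ' L N 0 (flatCfg : Site 4 → Fin 4 → (Matrix n n ℂ)ˣ) (X : TDir 4 n (L * N)) : ↥(skewSub 4 n N)) : TDir 4 n N)) P)
      ≤ ∑ p ∈ perWin 4 (L * N), nhsNormSq (curl (flatCfg : Site 4 → Fin 4 → (Matrix n n ℂ)ˣ)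
            (chartDir (ContinuousLinearMap.id ℝ (Matrix n n ℂ)) (L * N) (X : TDir 4 n (L * N))) p)
        + wallConst 4 L * (Real.sqrt ((((L * N : ℕ) : ℝ)) ^ 4 * (4 * Fintype.card (T4AveragingDeficitWall.Plane 4))) * 4 * γ
          * Real.sqrt (curlSq (flatCfg : Site 4 → Fin 4 → (Matrix n n ℂ)ˣ)
              (chartDir (ContinuousLinearMap.id ℝ (Matrix n n ℂ)) (L * N) (X : TDir 4 n (L * N))) (periodBox (d := 4) (L * N)))) := by
  haveI : NeZero (L * N) := ⟨Nat.mul_ne_zero (NeZero.ne L) (NeZero.ne N)⟩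
  haveI : CompleteSpace ↥(skewSub 4 n (L * N)) := FiniteDimensional.complete ℝ _
  set V₀ : Site 4 → Fin 4 → (Matrix n n ℂ)ˣ := flatCfg with hV₀def
  set Xt : Site 4 → Fin 4 → Matrix n n ℂ := chartDir (ContinuousLinearMap.id ℝ (Matrix n n ℂ)) (L * N) (X : TDir 4 n (L * N)) with hXt
  set Wp := blockWindow L (periodBox (d := 4) N) with hWp
  set F := blockSites L (periodBox (d := 4) N) with hFdef
  have hF : F = periodBox (d := 4) (L * N) := blockSites_periodBox L N hL
  set wC : ℝ := wallConst 4 L with hwC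
  have hwC0 : 0 ≤ wC := wallConst_nonneg 4 L
  set Kvol : ℝ := (((L * N : ℕ) : ℝ)) ^ 4 * (4 * Fintype.card (T4AveragingDeficitWall.Plane 4)) with hKvol
  have hKvol0 : 0 ≤ Kvol := by positivity
  have hV₀u : IsUnitaryCfg V₀ := isUnitaryCfg_flatCfg
  have hV₀P : IsPeriodicCfg V₀ ((L : ℤ) * N) := isPeriodicCfg_flatCfg _
  have hXskew : IsSkewDir Xt := fun x κ => X.2 (AveragingDeficitTorusChart.redN (L * N) x) κ
  have hXper : IsPeriodicDir Xt ((L : ℤ) * N) := by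
    have h := isPeriodicDir_chartDir (ContinuousLinearMap.id ℝ (Matrix n n ℂ)) (L * N) (X : TDir 4 n (L * N))
    have e : (((L * N : ℕ) : ℤ)) = (L : ℤ) * N := by push_cast; ring
    rw [hXt, ← e]; exact h
  -- sup bound `α` of the direction
  set α : ℝ := ‖(X : TDir 4 n (L * N))‖ with hα
  have hXα : ∀ x κ, ‖Xt x κ‖ ≤ α := fun x κ => by
    simp only [hXt, chartDir, ContinuousLinearMap.id_apply]
    exact (norm_le_pi_norm ((X : TDir 4 n (L * N)) (AveragingDeficitTorusChart.redN (L * N) x)) κ).trans (norm_le_pi_norm _ _)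
  have hα0 : 0 ≤ α := norm_nonneg _
  -- the flat variation `V_t = e^{tX̃}`, its smallness radius `a(t)`
  set V : ℝ → (Site 4 → Fin 4 → (Matrix n n ℂ)ˣ) := fun t => vary V₀ Xt t with hVdef
  have hVu : ∀ t, IsUnitaryCfg (V t) := fun t => vary_isUnitaryCfg hV₀u hXskew t
  have hVP : ∀ t, IsPeriodicCfg (V t) ((L : ℤ) * N) := fun t x κ μ => by
    simp only [hVdef, vary, hV₀P x κ μ, hXper x κ μ]
  set a : ℝ → ℝ := fun t => |t| * γ + 24 * Real.exp (|t| * α) * |t| ^ 2 * α ^ 2 with hadef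
  have ha0 : ∀ t, 0 ≤ a t := fun t => by simp only [hadef]; positivity
  have hsmall : ∀ t, SmallField (V t) (a t) := by
    intro t
    rcases le_or_gt 0 t with ht | ht
    · have h := smallField_vary_curl' hV₀u hXskew hXα hγ (by rw [hV₀def]; exact smallField_flatCfg_zero) ht
      simp only [zero_add] at h
      simp only [hadef, hVdef, abs_of_nonneg ht]
      exact h
    · have hnt : 0 ≤ -t := by linarith
      have hXα' : ∀ x κ, ‖(fun x κ => -Xt x κ) x κ‖ ≤ α := fun x κ => by simp only [norm_neg]; exact hXα x κ
      have hγ' : ∀ (z : Site 4) (μ ν : Fin 4), μ ≠ ν → ‖curlAt V₀ (fun x κ => -Xt x κ) z μ ν‖ ≤ γ := fun z μ ν h => by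
        rw [curlAt_neg, norm_neg]; exact hγ z μ ν h
      have hskew' : IsSkewDir (fun x κ => -Xt x κ) := fun x κ => (skewAdjoint (Matrix n n ℂ)).neg_mem (hXskew x κ)
      have h := smallField_vary_curl' hV₀u hskew' hXα' hγ' (by rw [hV₀def]; exact smallField_flatCfg_zero) hnt
      rw [vary_neg, neg_neg, zero_add] at h
      simp only [hadef, hVdef, abs_of_neg ht]
      exact h
  have hacont : ContinuousAt a 0 := by
    have h1 : Continuous a := by
      simp only [hadef]
      exact ((continuous_abs.mul continuous_const).add
        (((continuous_const.mul (Real.continuous_exp.comp (continuous_abs.mul continuous_const))).mul (continuous_abs.pow 2)).mul continuous_const))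
    exact h1.continuousAt
  have ha_at0 : a 0 = 0 := by simp only [hadef, abs_zero, zero_mul, zero_pow two_ne_zero, mul_zero, add_zero]
  -- the thresholds of the wall and of the flux bound, reached eventually
  set a₀ : ℝ := 1 / (512 * (4 + 1) * (4 + 4) * (L : ℝ) ^ 2) with ha₀
  have hL0 : (0 : ℝ) < L := by exact_mod_cast (lt_of_lt_of_le zero_lt_one hL)
  have ha₀0 : 0 < a₀ := by rw [ha₀]; positivity
  have ha₀K : 512 * ((4 : ℕ) + 1 : ℝ) * ((4 : ℕ) + 4) * (L : ℝ) ^ 2 * a₀ ≤ 1 := by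
    rw [ha₀]; push_cast; rw [mul_one_div_cancel (by positivity)]
  have hev : ∀ᶠ t : ℝ in 𝓝 0, a t < min a₀ (1 / 2) := by
    have h := hacont.tendsto; rw [ha_at0] at h
    exact h (gt_mem_nhds (lt_min ha₀0 (by norm_num)))
  -- the deficit along the variation and its derivative bound near `0`
  set g : ℝ → ℝ := fun t => deficit L (V t) Wp with hgdef
  set D : ℝ → ℝ := fun t => deriv (fun s : ℝ => deficit L (vary (V t) Xt s) Wp) 0 with hDdef
  set Bnd : ℝ → ℝ := fun t => wC * (Real.sqrt Kvol * 4 * a t * Real.sqrt (curlSq (V t) Xt F) + (a t) ^ 2 * (dirL1 Xt F + curlL1 (V t) Xt F)) with hBnd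
  have hderiv : ∀ᶠ t : ℝ in 𝓝 0, HasDerivAt g (D t) t ∧ |D t| ≤ Bnd t := by
    filter_upwards [hev] with t ht
    have hta₀ : a t ≤ a₀ := (ht.trans_le (min_le_left _ _)).le
    have hta2 : a t ≤ 1 / 2 := (ht.trans_le (min_le_right _ _)).le
    have hsm : 512 * ((4 : ℕ) + 1 : ℝ) * ((4 : ℕ) + 4) * (L : ℝ) ^ 2 * a t ≤ 1 :=
      (mul_le_mul_of_nonneg_left hta₀ (by positivity)).trans ha₀K
    have hD : HasDerivAt (fun s : ℝ => deficit L (vary (V t) Xt s) Wp) (D t) 0 :=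
      hasDerivAt_deficit_vary_per (d := 4) L hL (hVu t) (ha0 t) hsm (hsmall t) Xt N
    constructor
    · have hshift : (fun s : ℝ => deficit L (vary (V t) Xt s) Wp) = fun s : ℝ => g (t + s) := by
        funext s; simp only [hgdef, hVdef, vary_add]
      rw [hshift] at hD
      have hD' : HasDerivAt (fun s : ℝ => g (t + s)) (D t) (t - t) := by rw [sub_self]; exact hD
      have h2 := HasDerivAt.comp_sub_const t t hD'
      have e : (fun x : ℝ => (fun s : ℝ => g (t + s)) (x - t)) = g := by funext u; simp only [add_sub_cancel]
      rw [e] at h2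
      exact h2
    · have hwall := (deficitDerivWallPer_holds (d := 4) (n := n) L hL).deriv_bound hL ha₀K hN (hVu t) (hVP t) (ha0 t) hta₀ (hsmall t) hXskew hXper
      -- `gradFluxSq ≤ Kvol·(4a)²` from the sup bound `‖covGrad F‖ ≤ 4a`
      have hflux : ∀ p, ‖flux (V t) p‖ ≤ 2 * a t := fun p => norm_flux_le_of_smallField (hsmall t) hta2 p
      have hcov : ∀ (x : Site 4) (κ : Fin 4) (π : T4AveragingDeficitWall.Plane 4), ‖covGrad (V t) (flux (V t)) x κ π‖ ≤ 4 * a t := fun x κ π =>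
        (norm_covGrad_le (hVu t) _ x κ π).trans (by linarith [hflux (x + e κ, π), hflux (x, π)])
      have hgrad : gradFluxSq (V t) F ≤ Kvol * (4 * a t) ^ 2 := by
        rw [hF, hKvol]; exact gradFluxSq_le_of_sup (L * N) hcov
      have hsq : Real.sqrt (gradFluxSq (V t) F) ≤ Real.sqrt Kvol * 4 * a t := by
        calc Real.sqrt (gradFluxSq (V t) F) ≤ Real.sqrt (Kvol * (4 * a t) ^ 2) := Real.sqrt_le_sqrt hgrad
          _ = Real.sqrt Kvol * (4 * a t) := by rw [Real.sqrt_mul hKvol0, Real.sqrt_sq (by linarith [ha0 t])]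
          _ = Real.sqrt Kvol * 4 * a t := by ring
      refine hwall.trans ?_
      simp only [hBnd]
      have h1 : Real.sqrt (gradFluxSq (V t) F) * Real.sqrt (curlSq (V t) Xt F) ≤ Real.sqrt Kvol * 4 * a t * Real.sqrt (curlSq (V t) Xt F) :=
        mul_le_mul_of_nonneg_right hsq (Real.sqrt_nonneg _)
      exact mul_le_mul_of_nonneg_left (by linarith) hwC0
  -- `g` through the chart: `g t = 𝓓(chart_1 (t•X))`, `C²` at `0`, and `g″(0)` is the Maxwell-form difference
  set Dfun : ↥(skewSub 4 n (L * N)) → ℝ := fun s =>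
    deficit L (chart (ContinuousLinearMap.id ℝ (Matrix n n ℂ)) (L * N) V₀ (s : TDir 4 n (L * N))) Wp with hDfun
  set ℓ : ℝ →L[ℝ] ↥(skewSub 4 n (L * N)) := ContinuousLinearMap.toSpanSingleton ℝ X with hℓ
  have hgℓ : g = fun t : ℝ => Dfun (ℓ t) := by
    funext t
    simp only [hgdef, hDfun, hVdef, hℓ, ContinuousLinearMap.toSpanSingleton_apply, Submodule.coe_smul, chart_smul, hXt]
  have hDfc : ContDiffAt ℝ 2 Dfun (ℓ 0) := by
    rw [map_zero, hDfun, hWp, hV₀def]; exact contDiffAt_deficit_chart_flat (n := n) hL N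
  have hgc : ContDiffAt ℝ 2 g 0 := by
    rw [hgℓ]; exact ContDiffAt.comp (g := Dfun) (f := fun t : ℝ => ℓ t) 0 hDfc ℓ.contDiff.contDiffAt
  have hg'' : deriv (deriv g) 0 = fderiv ℝ (fderiv ℝ Dfun) 0 X X := by
    rw [← fderiv_fderiv_one_one, hgℓ, fderiv_fderiv_comp_clm ℓ hDfc, map_zero, ContinuousLinearMap.toSpanSingleton_apply_one]
  -- `deriv g = D` near `0`, `D 0 = 0`, and `deriv g` differentiable at `0`
  have hDg : ∀ᶠ t : ℝ in 𝓝 0, deriv g t = D t := hderiv.mono fun t ht => ht.1.deriv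
  have hD0 : D 0 = 0 := by
    have h := (hderiv.self_of_nhds).2
    simpa only [hBnd, ha_at0, mul_zero, zero_mul, zero_pow two_ne_zero, add_zero, abs_nonpos_iff] using h
  have hd1 : HasDerivAt (deriv g) (deriv (deriv g) 0) 0 := by
    have h1 : ContDiffAt ℝ 1 (fderiv ℝ g) 0 := hgc.fderiv_right (by norm_num)
    have h2 : ContDiffAt ℝ 1 (fun t : ℝ => fderiv ℝ g t 1) 0 := h1.clm_apply contDiffAt_const
    have h3 : (fun t : ℝ => fderiv ℝ g t 1) = deriv g := by funext t; rfl
    rw [h3] at h2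
    exact (h2.differentiableAt one_ne_zero).hasDerivAt
  have hdD : HasDerivAt D (deriv (deriv g) 0) 0 := by
    refine hd1.congr_of_eventuallyEq (hDg.mono fun t ht => ht.symm)
  -- continuity at `0` of the bound's ingredients
  have hcurl_cont : ∀ p : T4AveragingDeficitWall.Plaq 4, ContinuousAt (fun t : ℝ => curl (V t) Xt p) 0 := fun p =>
    (hasDerivAt_curl_vary V₀ Xt Xt p).continuousAt
  have hcurlSq_cont : ContinuousAt (fun t : ℝ => curlSq (V t) Xt F) 0 := by
    simp only [curlSq]
    exact tendsto_finsetSum _ fun z _ => tendsto_finsetSum _ fun π _ => ((hcurl_cont (z, π)).norm.pow 2)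
  have hcurlL1_cont : ContinuousAt (fun t : ℝ => curlL1 (V t) Xt F) 0 := by
    simp only [curlL1]
    exact tendsto_finsetSum _ fun z _ => tendsto_finsetSum _ fun π _ => (hcurl_cont (z, π)).norm
  have hV0 : V 0 = V₀ := by simp only [hVdef, vary_zero]
  -- the limit of `Bnd t / |t|`
  set A : ℝ := wC * (Real.sqrt Kvol * 4 * γ * Real.sqrt (curlSq V₀ Xt F)) with hA
  have hquot : ∀ t : ℝ, t ≠ 0 → Bnd t / |t| = wC * (Real.sqrt Kvol * 4 * (γ + 24 * Real.exp (|t| * α) * |t| * α ^ 2) * Real.sqrt (curlSq (V t) Xt F)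
      + |t| * (γ + 24 * Real.exp (|t| * α) * |t| * α ^ 2) ^ 2 * (dirL1 Xt F + curlL1 (V t) Xt F)) := by
    intro t ht
    have htabs : |t| ≠ 0 := abs_ne_zero.mpr ht
    simp only [hBnd, hadef]
    field_simp
  have hlim : Tendsto (fun t : ℝ => Bnd t / |t|) (𝓝[≠] 0) (𝓝 A) := by
    have hrate : ContinuousAt (fun t : ℝ => γ + 24 * Real.exp (|t| * α) * |t| * α ^ 2) 0 :=
      (continuous_const.add (((continuous_const.mul (Real.continuous_exp.comp (continuous_abs.mul continuous_const))).mul continuous_abs).mul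
        continuous_const)).continuousAt
    have hmain : Tendsto (fun t : ℝ => wC * (Real.sqrt Kvol * 4 * (γ + 24 * Real.exp (|t| * α) * |t| * α ^ 2) * Real.sqrt (curlSq (V t) Xt F)
        + |t| * (γ + 24 * Real.exp (|t| * α) * |t| * α ^ 2) ^ 2 * (dirL1 Xt F + curlL1 (V t) Xt F))) (𝓝 0) (𝓝 A) := by
      have h1 : Tendsto (fun t : ℝ => γ + 24 * Real.exp (|t| * α) * |t| * α ^ 2) (𝓝 0) (𝓝 γ) := by
        have h := hrate.tendsto
        simp only [abs_zero, zero_mul, Real.exp_zero, mul_zero, add_zero] at h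
        exact h
      have h2 : Tendsto (fun t : ℝ => Real.sqrt (curlSq (V t) Xt F)) (𝓝 0) (𝓝 (Real.sqrt (curlSq V₀ Xt F))) := by
        have h := hcurlSq_cont.tendsto; simp only [hV0] at h; exact h.sqrt
      have h3 : Tendsto (fun t : ℝ => dirL1 Xt F + curlL1 (V t) Xt F) (𝓝 0) (𝓝 (dirL1 Xt F + curlL1 V₀ Xt F)) := by
        have h := hcurlL1_cont.tendsto; simp only [hV0] at h; exact tendsto_const_nhds.add h
      have h4 : Tendsto (fun t : ℝ => |t|) (𝓝 0) (𝓝 0) := by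
        have h := (continuous_abs.tendsto (0 : ℝ)); rwa [abs_zero] at h
      have h5 : Tendsto (fun t : ℝ => |t| * (γ + 24 * Real.exp (|t| * α) * |t| * α ^ 2) ^ 2 * (dirL1 Xt F + curlL1 (V t) Xt F)) (𝓝 0) (𝓝 0) := by
        have h := (h4.mul (h1.pow 2)).mul h3
        simp only [zero_mul] at h; exact h
      have h6 := (tendsto_const_nhds (x := wC)).mul ((((tendsto_const_nhds (x := Real.sqrt Kvol * 4)).mul h1).mul h2).add h5)
      simp only [add_zero] at h6
      rw [hA]
      convert h6 using 2
    refine (hmain.mono_left nhdsWithin_le_nhds).congr' ?_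
    filter_upwards [self_mem_nhdsWithin] with t ht
    exact (hquot t ht).symm
  -- conclusion: `|g″(0)| ≤ A`
  have hB : ∀ᶠ t : ℝ in 𝓝[≠] 0, |D t| ≤ Bnd t := (hderiv.mono fun t ht => ht.2).filter_mono nhdsWithin_le_nhds
  have habs : |deriv (deriv g) 0| ≤ A := abs_deriv_le_of_slope_bound hdD hD0 hB hlim
  have hid := deficit_second_variation_flat (n := n) hL N X
  rw [← hV₀def, ← hXt] at hid
  have hfinal : fderiv ℝ (fderiv ℝ Dfun) 0 X X ≤ A := by rw [← hg'']; exact (le_abs_self _).trans habs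
  rw [hDfun, hWp, hid] at hfinal
  have hA' : A = wallConst 4 L * (Real.sqrt ((((L * N : ℕ) : ℝ)) ^ 4 * (4 * Fintype.card (T4AveragingDeficitWall.Plane 4))) * 4 * γ
      * Real.sqrt (curlSq V₀ Xt (periodBox (d := 4) (L * N)))) := by rw [hA, hwC, hKvol, hF]
  linarith [hfinal, hA']

end

end Summit.QuantumFields.BalabanUV.T4Continuum.NE7CoarseCurlEnergyFlat
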